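import Mathlib
import Summits.Ventures.PercRepro2.Defs
import Summits.Ventures.PercRepro2.Graph
import Summits.Ventures.PercRepro2.Harris
import Summits.Ventures.PercRepro2.Events
import Summits.Ventures.PercRepro2.Independence
import Summits.Ventures.PercRepro2.Induced
import Summits.Ventures.PercRepro2.Exploration
import Summits.Ventures.PercRepro2.GateDefs
import Summits.Ventures.PercRepro2.GateAnatomy
import Summits.Ventures.PercRepro2.GateForest
import Summits.Ventures.PercRepro2.GateLSM
import Summits.Ventures.PercRepro2.HullTree
import Summits.Ventures.PercRepro2.GateFeedbackForest
import Summits.Ventures.PercRepro2.GateFeedback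
import Summits.Ventures.PercRepro2.GateFeedbackExit
import Summits.Ventures.PercRepro2.GateContract
import Summits.Ventures.PercRepro2.GateShadow
import Summits.Ventures.PercRepro2.GateSide
import Summits.Ventures.PercRepro2.GateSep
import Summits.Ventures.PercRepro2.SideCluster
import Summits.Ventures.PercRepro2.CactusDefs
import Summits.Ventures.PercRepro2.CactusTriangle
import Summits.Ventures.PercRepro2.CactusTriangleMass
import Summits.Ventures.PercRepro2.CactusCluster
import Summits.Ventures.PercRepro2.CactusChain

import Summits.Ventures.PercRepro2.CactusKappa

/-!
# THEOREM 2: the free one-sided gate when `G − t` (or `G − w`) is a triangular cactus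
(blind cell PercRepro2, mine-c g11; proofs/MINEC-FEEDBACK.md §8 and §14)

Row 2′CON-W, `|T| = 1`: root `s`, avoided vertex `t`, markers `a, b`, entry `u`, exit `w`. The
class-B mass factorises in every graph (`GateSep.massB_eq_connDel`)
  `massB W = 1[t,u,w ∉ W] · P(C(s) = W) · κ(W)`,  `κ(W) = P(t ↔ w in G ∖ W)`,
and the gate follows from the FKG lattice condition on `massB` (`GateSep.gateRow_of_massBLogSupermod`).
When `G − t` is a triangular cactus built from the root (`IsCactusFrom ends s (Ft ends t)`):

* `P(C(s) = W) = massOn (G − t) W · τ(W)` (`prob_clusterEvent_eq_massOn`): the cluster law of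
  `G − t` on the same configuration space times the closed-edge factor of the `W–t` edges; the first
  factor is log-supermodular (`Cactus.massOn_lsm`, g10), the second is modular (`tau_mul`, g9);
* `κ` is log-supermodular on root clusters (`kappa_lsm`): by the CHAIN LEMMA
  (`CactusChain.chain`) the component of `w` in `G − t − W₁` misses `W₂` or the component of `w`
  in `G − t − W₂` misses `W₁`; in the first case every open connection `t ↔ w` avoiding `W₁`
  avoids `W₂` as well (`connDelEvent_subset_of_not_reach`: look at the first arrival at `t`), so
  `κ(W₁) ≤ κ(W₁ ∪ W₂)` while `κ(W₂) ≤ κ(W₁ ∩ W₂)` trivially — no block paths, no frontier order.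

**THEOREM 2** (`gateRow_of_isCactus_del`): `G − t` a triangular cactus ⟹
`Gate.GateRow p ends s {t} a b {u} {w}` for every `s, a, b, u` and `w ≠ t`; **THEOREM 2′**
(`gateRow_of_isCactus_del_exit`): the same when `G − w` is a triangular cactus (by the
`(t, w)`-symmetry `GateSep.massB_comm`). With the separator reductions of g10 the hypothesis is
only needed on `G − z` for a cut vertex `z` between the exit and the avoided vertex
(`gateRow_of_sep_exit_of_isCactus_del_exit`, `gateRow_of_sep_avoid_of_isCactus_del`).
Forests are triangular cacti, so Theorems 1 / 1′ of g9 are the special case without triangles.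
-/

namespace Summit.Ventures.PercRepro2

namespace CactusGate

open Cactus CactusChain GateSide

open scoped Classical

variable {V : Type*} {E : Type*} [Fintype E] [Fintype V]
variable {R : Type*} [Field R] [LinearOrder R] [IsStrictOrderedRing R]
variable {ends : E → Sym2 V}

/-! ## The cluster law of `G` through the cluster law of `G − t` (same configuration space) -/

omit [Fintype E] [Fintype V] in
/-- An open walk of `G` avoiding `t` is an open walk of `G − t` (`restrict (Ft) ω`). -/
lemma conn_restrict_of_walk {t : V} {ω : Config E} {x y : V} (q : (openGraph ends ω).Walk x y)
    (ht : t ∉ q.support) : Conn ends (restrict (GateFeedback.Ft ends t) ω) x y := by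
  refine ⟨q.transfer (openGraph ends (restrict (GateFeedback.Ft ends t) ω)) ?_⟩
  intro e he
  induction e using Sym2.ind with
  | h a b =>
    have hadj : (openGraph ends ω).Adj a b := q.adj_of_mem_edges he
    have ha : a ∈ q.support := q.fst_mem_support_of_mem_edges he
    have hb : b ∈ q.support := q.snd_mem_support_of_mem_edges he
    rw [openGraph_adj] at hadj
    obtain ⟨hne, e', he', hends⟩ := hadj
    have hta : a ≠ t := fun h => ht (h ▸ ha)
    have htb : b ≠ t := fun h => ht (h ▸ hb)
    have hF : e' ∈ GateFeedback.Ft ends t := by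
      show t ∉ ends e'
      rw [hends, Sym2.mem_iff]
      rintro (h | h)
      · exact hta h.symm
      · exact htb h.symm
    rw [SimpleGraph.mem_edgeSet, openGraph_adj]
    exact ⟨hne, e', restrict_eq_true_iff.2 ⟨he', hF⟩, hends⟩

omit [Fintype E] [Fintype V] in
/-- If `s ↮ t`, the cluster of `s` in `G` is its cluster in `G − t`. -/
lemma cluster_eq_cluster_restrict {t s : V} {ω : Config E} (hst : ¬ Conn ends ω s t) :
    cluster ends ω s = cluster ends (restrict (GateFeedback.Ft ends t) ω) s := by
  ext x
  simp only [mem_cluster]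
  constructor
  · rintro ⟨q⟩
    exact conn_restrict_of_walk q fun ht => hst ⟨q.takeUntil t ht⟩
  · exact conn_mono (restrict_le _ _)

omit [Fintype V] in
/-- The cluster event `{C(s) = W}` of `G`, for `t ∉ W`: the cluster event of `G − t` on the same
configuration space, together with «every edge between `W` and `t` is closed». -/
lemma clusterEvent_eq_restrict {t s : V} {W : Finset V} (ht : t ∉ W) (ω : Config E) :
    ω ∈ clusterEvent ends s (↑W : Set V) ↔
      clusterOn ends (GateFeedback.Ft ends t) ω s = ↑W ∧
        ∀ e ∈ GateFeedback.Et ends t W, ω e = false := by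
  simp only [mem_clusterEvent, clusterOn]
  constructor
  · intro h
    have hst : ¬ Conn ends ω s t := by
      intro hc
      have : t ∈ cluster ends ω s := hc
      rw [h] at this
      exact ht (Finset.mem_coe.1 this)
    refine ⟨by rw [← cluster_eq_cluster_restrict hst, h], ?_⟩
    intro e he
    simp only [GateFeedback.Et, Finset.mem_filter, Finset.mem_univ, true_and] at he
    obtain ⟨x, hx, hex⟩ := he
    by_contra hopen
    have hopen' : ω e = true := by
      cases h' : ω e with
      | true => rfl
      | false => exact absurd h' hopen
    have hsx : Conn ends ω s x := by
      have : x ∈ cluster ends ω s := by rw [h]; exact Finset.mem_coe.2 hx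
      exact this
    exact hst (hsx.trans (conn_of_openAdj ⟨e, hopen', hex⟩))
  · rintro ⟨hF, hclosed⟩
    have hst : ¬ Conn ends ω s t := by
      intro hc
      have hsne : s ≠ t := by
        rintro rfl
        have : s ∈ cluster ends (restrict (GateFeedback.Ft ends s) ω) s := mem_cluster_self _ _ _
        rw [hF] at this
        exact ht (Finset.mem_coe.1 this)
      rcases exists_first_arrival ((SimpleGraph.reachable_iff_reflTransGen _ _).1 hc) with
        hst' | ⟨v, hsv, hvt, hadj⟩
      · exact hsne hst'
      · have hv : Conn ends (restrict (GateFeedback.Ft ends t) ω) s v := by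
          refine reachable_of_reflTransGen_avoid ?_ hsv hvt
          intro a b hat hbt hab
          rw [openGraph_adj] at hab ⊢
          obtain ⟨hne, e, he, hends⟩ := hab
          refine ⟨hne, e, restrict_eq_true_iff.2 ⟨he, ?_⟩, hends⟩
          show t ∉ ends e
          rw [hends, Sym2.mem_iff]
          rintro (h | h)
          · exact hat h.symm
          · exact hbt h.symm
        have hvW : v ∈ W := by
          have : v ∈ cluster ends (restrict (GateFeedback.Ft ends t) ω) s := hv
          rw [hF] at this
          exact Finset.mem_coe.1 this
        rw [openGraph_adj] at hadj
        obtain ⟨_, e, he, hends⟩ := hadj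
        have := hclosed e (by
          simp only [GateFeedback.Et, Finset.mem_filter, Finset.mem_univ, true_and]
          exact ⟨v, hvW, hends⟩)
        rw [he] at this
        exact Bool.true_eq_false.mp this |>.elim
    rw [cluster_eq_cluster_restrict hst]
    exact hF

omit [Fintype E] [Fintype V] in
/-- `allClosed F` is determined by the edges of `F`. -/
lemma dependsOn_allClosed (F : Finset E) : DependsOn (· ∈ allClosed F) (↑F : Set E) := by
  intro ω ω' h
  simp only [allClosed, Set.mem_setOf_eq]
  exact propext ⟨fun hω e he => by rw [← h e (Finset.mem_coe.2 he)]; exact hω e he,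
    fun hω e he => by rw [h e (Finset.mem_coe.2 he)]; exact hω e he⟩

omit [Fintype V] [LinearOrder R] [IsStrictOrderedRing R] in
/-- **The cluster law of `G` through `G − t`**: for `t ∉ W`,
`P(C(s) = W) = massOn (G − t) W · τ(W)`. -/
theorem prob_clusterEvent_eq_massOn (p : E → R) {s t : V} {W : Finset V} (ht : t ∉ W) :
    prob p (clusterEvent ends s (↑W : Set V)) =
      massOn p ends (GateFeedback.Ft ends t) s W * GateFeedback.tau p ends t W := by
  have hset : clusterEvent ends s (↑W : Set V) =
      {ω | clusterOn ends (GateFeedback.Ft ends t) ω s = ↑W} ∩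
        allClosed (GateFeedback.Et ends t W) := by
    ext ω
    rw [Set.mem_inter_iff, Set.mem_setOf_eq, clusterEvent_eq_restrict ht ω]
    rfl
  have hdep : DependsOn (· ∈ {ω : Config E | clusterOn ends (GateFeedback.Ft ends t) ω s = ↑W})
      (GateFeedback.Ft ends t) :=
    dependsOn_restrict (GateFeedback.Ft ends t) (fun ω' => cluster ends ω' s = ↑W)
  have hdisj : Disjoint (GateFeedback.Ft ends t) (↑(GateFeedback.Et ends t W) : Set E) := by
    rw [Set.disjoint_left]
    intro e he he'
    simp only [Finset.coe_filter, GateFeedback.Et, Finset.mem_univ, true_and,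
      Set.mem_setOf_eq] at he'
    obtain ⟨x, _, hex⟩ := he'
    exact he (by rw [hex]; exact Sym2.mem_mk_right _ _)
  rw [hset, prob_inter_eq_mul_of_dependsOn p hdisj hdep (dependsOn_allClosed _), prob_allClosed]
  rfl

/-! ## THEOREM 2: the FKG lattice condition when `G − t` is a triangular cactus -/

/-- **The core inequality**: for root clusters `W₁, W₂` avoiding `t` and `w`, the product
`P(C(s) = W) · κ(W)` is log-supermodular when `G − t` is a triangular cactus (the three factors
`massOn`, `τ`, `κ` are log-supermodular, modular, log-supermodular on root clusters). -/
theorem core_lsm {p : E → R} (hp : IsProbVec p) {s t w : V}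
    (hF : IsCactusFrom ends s (GateFeedback.Ft ends t)) (hw : w ≠ t) {W₁ W₂ : Finset V}
    (ht₁ : t ∉ W₁) (ht₂ : t ∉ W₂) (hw₁ : w ∉ W₁) (hw₂ : w ∉ W₂) :
    prob p (clusterEvent ends s (↑W₁ : Set V)) * prob p (connDelEvent ends W₁ t w) *
        (prob p (clusterEvent ends s (↑W₂ : Set V)) * prob p (connDelEvent ends W₂ t w)) ≤
      prob p (clusterEvent ends s (↑(W₁ ∩ W₂) : Set V)) * prob p (connDelEvent ends (W₁ ∩ W₂) t w) *
        (prob p (clusterEvent ends s (↑(W₁ ∪ W₂) : Set V)) *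
          prob p (connDelEvent ends (W₁ ∪ W₂) t w)) := by
  have htI : t ∉ W₁ ∩ W₂ := fun h => ht₁ (Finset.mem_inter.1 h).1
  have htU : t ∉ W₁ ∪ W₂ := by
    intro h
    rcases Finset.mem_union.1 h with h | h
    · exact ht₁ h
    · exact ht₂ h
  rw [prob_clusterEvent_eq_massOn p ht₁, prob_clusterEvent_eq_massOn p ht₂,
    prob_clusterEvent_eq_massOn p htI, prob_clusterEvent_eq_massOn p htU]
  -- the three factors
  have hν0 : ∀ W, 0 ≤ massOn p ends (GateFeedback.Ft ends t) s W := fun W => prob_nonneg hp _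
  have hκ0 : ∀ W, 0 ≤ prob p (connDelEvent ends W t w) := fun W => prob_nonneg hp _
  have hτ0 : ∀ W, 0 ≤ GateFeedback.tau p ends t W := fun W => GateFeedback.tau_nonneg hp ends t W
  have hA := Cactus.massOn_lsm hp hF W₁ W₂
  have hB := GateFeedback.tau_mul p ends t W₁ W₂
  -- if one of the cactus masses vanishes the left side is `0`
  by_cases hz₁ : massOn p ends (GateFeedback.Ft ends t) s W₁ = 0
  · rw [hz₁]
    simp only [zero_mul]
    exact mul_nonneg (mul_nonneg (mul_nonneg (hν0 _) (hτ0 _)) (hκ0 _))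
      (mul_nonneg (mul_nonneg (hν0 _) (hτ0 _)) (hκ0 _))
  by_cases hz₂ : massOn p ends (GateFeedback.Ft ends t) s W₂ = 0
  · rw [hz₂]
    simp only [zero_mul, mul_zero]
    exact mul_nonneg (mul_nonneg (mul_nonneg (hν0 _) (hτ0 _)) (hκ0 _))
      (mul_nonneg (mul_nonneg (hν0 _) (hτ0 _)) (hκ0 _))
  -- both are root clusters of the cactus: the chain lemma applies
  have hz₁' : prob p {ω : Config E | clusterOn ends (GateFeedback.Ft ends t) ω s = ↑W₁} ≠ 0 := hz₁
  have hz₂' : prob p {ω : Config E | clusterOn ends (GateFeedback.Ft ends t) ω s = ↑W₂} ≠ 0 := hz₂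
  obtain ⟨ω₁, hω₁⟩ := GateFeedback.nonempty_of_prob_ne_zero hz₁'
  obtain ⟨ω₂, hω₂⟩ := GateFeedback.nonempty_of_prob_ne_zero hz₂'
  have hC := kappa_lsm hp hF hω₁ hω₂ ht₁ ht₂ hw₁ hw₂ hw
  exact GateFeedback.three_factor hA hB hC (mul_nonneg (hτ0 _) (hτ0 _))
    (mul_nonneg (hκ0 _) (hκ0 _))
    (mul_nonneg (mul_nonneg (hν0 _) (hν0 _)) (mul_nonneg (hτ0 _) (hτ0 _)))

/-- **THEOREM 2 (cactus gate, FKG form).** If `G − t` is a triangular cactus built from the root,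
the class-B mass `W ↦ P(C(s) = W ∧ w ∈ C(t) ∧ s ↮ t, u)` is log-supermodular on `Finset V`. -/
theorem massBLogSupermod_of_isCactus_del {p : E → R} (hp : IsProbVec p) {s t u w : V}
    (hF : IsCactusFrom ends s (GateFeedback.Ft ends t)) (hw : w ≠ t) :
    GateLSM.MassBLogSupermod p ends s t u w := by
  intro W₁ W₂
  have hnn : ∀ W, 0 ≤ GateLSM.massB p ends s t u w W := fun W => prob_nonneg hp _
  by_cases h₁ : t ∈ W₁ ∨ u ∈ W₁ ∨ w ∈ W₁
  · rw [GateSep.massB_eq_connDel p ends s t u w W₁, if_pos h₁, zero_mul]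
    exact mul_nonneg (hnn _) (hnn _)
  by_cases h₂ : t ∈ W₂ ∨ u ∈ W₂ ∨ w ∈ W₂
  · rw [GateSep.massB_eq_connDel p ends s t u w W₂, if_pos h₂, mul_zero]
    exact mul_nonneg (hnn _) (hnn _)
  simp only [not_or] at h₁ h₂
  obtain ⟨ht₁, hu₁, hw₁⟩ := h₁
  obtain ⟨ht₂, hu₂, hw₂⟩ := h₂
  have hI : ¬ (t ∈ W₁ ∩ W₂ ∨ u ∈ W₁ ∩ W₂ ∨ w ∈ W₁ ∩ W₂) := by
    rintro (h | h | h)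
    · exact ht₁ (Finset.mem_inter.1 h).1
    · exact hu₁ (Finset.mem_inter.1 h).1
    · exact hw₁ (Finset.mem_inter.1 h).1
  have hU : ¬ (t ∈ W₁ ∪ W₂ ∨ u ∈ W₁ ∪ W₂ ∨ w ∈ W₁ ∪ W₂) := by
    rintro (h | h | h)
    · rcases Finset.mem_union.1 h with h | h
      · exact ht₁ h
      · exact ht₂ h
    · rcases Finset.mem_union.1 h with h | h
      · exact hu₁ h
      · exact hu₂ h
    · rcases Finset.mem_union.1 h with h | h
      · exact hw₁ h
      · exact hw₂ h
  rw [GateSep.massB_eq_connDel p ends s t u w W₁, GateSep.massB_eq_connDel p ends s t u w W₂,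
    GateSep.massB_eq_connDel p ends s t u w (W₁ ∩ W₂),
    GateSep.massB_eq_connDel p ends s t u w (W₁ ∪ W₂),
    if_neg (by simp only [not_or]; exact ⟨ht₁, hu₁, hw₁⟩),
    if_neg (by simp only [not_or]; exact ⟨ht₂, hu₂, hw₂⟩), if_neg hI, if_neg hU]
  exact core_lsm hp hF hw ht₁ ht₂ hw₁ hw₂

/-- **THEOREM 2′ (exit version, FKG form).** If `G − w` is a triangular cactus built from the root,
the class-B mass is log-supermodular (the `(t, w)`-symmetry of the class-B mass). -/
theorem massBLogSupermod_of_isCactus_del_exit {p : E → R} (hp : IsProbVec p) {s t u w : V}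
    (hF : IsCactusFrom ends s (GateFeedback.Ft ends w)) (hw : w ≠ t) :
    GateLSM.MassBLogSupermod p ends s t u w :=
  GateSep.massBLogSupermod_comm (massBLogSupermod_of_isCactus_del hp hF hw.symm)

/-! ## The gate -/

/-- **THEOREM 2 (the cactus gate).** If every cycle of `G` avoiding the avoided vertex `t` is a
triangle (`G − t` a triangular cactus built from the root), the free one-sided gate holds for every
root `s`, markers `a, b`, entry `u` and exit `w ≠ t`: `Gate.GateRow s {t} a b {u} {w}`. -/
theorem gateRow_of_isCactus_del {p : E → R} (hp : IsProbVec p) (s t a b u w : V)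
    (hF : IsCactusFrom ends s (GateFeedback.Ft ends t)) (hw : w ≠ t) :
    Gate.GateRow p ends s {t} a b {u} {w} :=
  GateSep.gateRow_of_massBLogSupermod hp s t a b u w (massBLogSupermod_of_isCactus_del hp hF hw)

/-- **THEOREM 2′ (the cactus gate, exit version).** If every cycle of `G` avoiding the exit `w` is a
triangle, the free one-sided gate holds. -/
theorem gateRow_of_isCactus_del_exit {p : E → R} (hp : IsProbVec p) (s t a b u w : V)
    (hF : IsCactusFrom ends s (GateFeedback.Ft ends w)) (hw : w ≠ t) :
    Gate.GateRow p ends s {t} a b {u} {w} :=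
  GateSep.gateRow_of_massBLogSupermod hp s t a b u w
    (massBLogSupermod_of_isCactus_del_exit hp hF hw)

/-- **Every cycle through a separator, cactus base**: if `z` separates `w` from `t`, the root is
not beyond `z`, and `G − z` is a triangular cactus, the free gate holds. -/
theorem gateRow_of_sep_exit_of_isCactus_del_exit {p : E → R} (hp : IsProbVec p)
    (s t a b u w z : V) (hsep : w ∉ side ends z t) (hside : w ∉ side ends z s) (hwz : w ≠ z)
    (htz : t ≠ z) (hF : IsCactusFrom ends s (GateFeedback.Ft ends z)) :
    Gate.GateRow p ends s {t} a b {u} {w} :=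
  GateSep.gateRow_of_sep_exit hp s t a b u w z hsep hside hwz htz
    (massBLogSupermod_of_isCactus_del_exit hp hF htz.symm)

/-- **Every cycle through a separator, avoided side, cactus base**: if `z` separates `t` from `w`,
the root is not beyond `z`, and `G − z` is a triangular cactus, the free gate holds. -/
theorem gateRow_of_sep_avoid_of_isCactus_del {p : E → R} (hp : IsProbVec p)
    (s t a b u w z : V) (hsep : t ∉ side ends z w) (hside : t ∉ side ends z s) (htz : t ≠ z)
    (hwz : w ≠ z) (hF : IsCactusFrom ends s (GateFeedback.Ft ends z)) :
    Gate.GateRow p ends s {t} a b {u} {w} :=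
  GateSep.gateRow_of_sep_avoid hp s t a b u w z hsep hside htz hwz
    (massBLogSupermod_of_isCactus_del hp hF hwz)

end CactusGate

end Summit.Ventures.PercRepro2
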